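import Literature.LinearAlgebra.Matrix.IntegralConjugacyOfRegularElements   -- ★ (F1) Kottwitz Prop. 7.1 for `GL_m` over a local ring: companion form, integral conjugacy, orbit lemma
import Literature.NumberTheory.Automorphic.IntegralMatrixReduction            -- ★ `IntegralReduction.redMat`, `redMat_mapMatrix`
import Literature.NumberTheory.Automorphic.ReductiveGroupData                 -- ★ `glInt` (= `(GeneralLinearGroup.map 𝒪[E].subtype).range`)
import HarnessLib

/-!
# Residually regular conjugacy in `GL_n(𝒪)`: two integral elements with the same characteristic polynomial, separable modulo `𝔭`,
# are `GL_n(𝒪)`-conjugate — `(G·γ) ∩ K` is ONE `K`-class (Kottwitz 1986, Prop. 7.1 for `G = GL_n`, `K = GL_n(𝒪)`)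

Topic `NumberTheory/Automorphic`; namespace `Literature.NumberTheory.Automorphic.GLn`.  THEOREMS ONLY (no definition, no instance, no notation, no named
fact, no `sorry`).  Cell `hodgecm-mathlib`, F0∕P3a road D-S «singular∕unit orbital integrals», brick «D-S3c» (LEAD F0P3a-plan (g8) T7-17 (D); seat B-p14 (g29)).

THIS IS A DOCKING FILE: the mathematics — a residually separable characteristic polynomial gives an integral Krylov basis (Nakayama on the cyclic vector),
hence conjugacy to the companion matrix over the LOCAL ring `𝒪`, hence `GL_m(𝒪)`-conjugacy of any two such matrices with the same characteristic
polynomial, hence Kottwitz's orbit lemma — is ★ `Literature/LinearAlgebra/Matrix/IntegralConjugacyOfRegularElements` (`exists_isUnit_det_mul_eq_mul_companion_of_separable`,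
`exists_isUnit_det_conj_of_charpoly_eq`, `mem_range_map_mul_centralizer_of_conj_mem_range`).  Here it is read in the tree's `GL_n(E)` ∕ ★ `glInt n E`
currency for a field `E` with a valuative relation (`𝒪 = 𝒪[E]`, `𝓀 = 𝓀[E]`; ★ `glInt n E` IS `(GeneralLinearGroup.map 𝒪[E].subtype).range` by definition), with
residual separability stated on the REDUCED MATRIX ★ `IntegralReduction.redMat γ` (no lift to quantify over):
* `GLn.charpoly_redMat_map_eq` — for `γ_𝒪 ∈ GL_n(𝒪)`, `(redMat (γ_𝒪 ⊗ 1)).charpoly = (charpoly γ_𝒪).map residue`;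
* **`GLn.exists_mem_glInt_conj_eq_of_charpoly_eq_of_separable_redMat`** (c2) — `γ, γ′ ∈ glInt n E`, `charpoly γ′ = charpoly γ` (over `E`),
  `(redMat γ).charpoly` separable ⇒ `∃ k ∈ glInt n E, k * γ * k⁻¹ = γ′`;
* **`GLn.forall_exists_mem_glInt_conj_eq_of_isConj`** (c3) — the SINGLE-`K`-CLASS property in the binder shape `hK1` of ★-pending
  `ResiduallyRegularOrbitalIntegral` (F0P3b-p01 (g5)): `∀ γ′ ∈ glInt n E, IsConj γ γ′ → ∃ k ∈ glInt n E, k * γ * k⁻¹ = γ′`;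
* `GLn.mem_glInt_mul_centralizer_of_conj_mem_glInt` (c5) — Kottwitz's orbit form «`y γ y⁻¹ ∈ K ⇒ y ∈ K · G_γ(E)`» in `glInt` tokens.
NOT «merely non-scalar mod `𝔭`»: `[[a,1],[0,a+ϖ]]` and `diag(a, a+ϖ)` are `GL₂(E)`-conjugate, both integral, NOT `GL₂(𝒪)`-conjugate — separability of the reduced
characteristic polynomial is the right hypothesis.  NOT HERE: (c4) `hcore` «`G_γ ∩ K = compactCore G_γ`» (needs `𝒪[γ]` = the maximal order of `E[γ]`; sibling
file); the unitary upgrade (★ `IntegralUnitaryConjugacyOfRegularElements` ∕ `…Complete`).  HC_CM is proved only modulo the printed citations until rung 0 closes;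
this file is count-neutral (D-S road plumbing, #88 K7-s inputs).

## References
* [Kottwitz1986] R. E. Kottwitz, *Stable trace formula: elliptic singular terms*, Math. Ann. 275 (1986), §7 Prop. 7.1, Cor. 7.3.
* [HornJohnson2013] R. A. Horn, C. R. Johnson, *Matrix Analysis* (2nd ed., 2013), Thm. 3.3.15 p. 257 (nonderogatory ⇔ similar to the companion matrix).
* [Rogawski1990] J. D. Rogawski, *Automorphic Representations of Unitary Groups in Three Variables* (1990), §3.3 p. 21, §4.9 p. 54.
-/

set_option autoImplicit false

noncomputable section

open Matrix ValuativeRel Polynomial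
open scoped Matrix MatrixGroups ValuativeRel Pointwise

namespace Literature.NumberTheory.Automorphic.GLn

open Literature.LinearAlgebra.Matrix Literature.NumberTheory.Automorphic.IntegralReduction

universe u

variable {E : Type u} [Field E] [ValuativeRel E] {n : ℕ}

/-- The `GL_n(E)`-avatar of `γ_𝒪 ∈ GL_n(𝒪)` has matrix `γ_𝒪 ⊗ 1 = 𝒪[E].subtype.mapMatrix γ_𝒪`. [folklore] -/
private theorem coe_map_subtype (γO : GL (Fin n) 𝒪[E]) :
    ((Matrix.GeneralLinearGroup.map (𝒪[E]).subtype γO : GL (Fin n) E) : Matrix (Fin n) (Fin n) E) =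
      (𝒪[E]).subtype.mapMatrix (γO : Matrix (Fin n) (Fin n) 𝒪[E]) := rfl

/-- **The reduced matrix of an integral element has the reduced characteristic polynomial**: for `γ_𝒪 ∈ GL_n(𝒪)`,
`(redMat (γ_𝒪 ⊗ 1)).charpoly = (charpoly γ_𝒪).map residue`. [cite: Kottwitz1986, Prop. 7.1] -/
theorem charpoly_redMat_map_eq (γO : GL (Fin n) 𝒪[E]) :
    (redMat ((Matrix.GeneralLinearGroup.map (𝒪[E]).subtype γO : GL (Fin n) E) : Matrix (Fin n) (Fin n) E)).charpoly =
      (γO : Matrix (Fin n) (Fin n) 𝒪[E]).charpoly.map (IsLocalRing.residue 𝒪[E]) := by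
  rw [coe_map_subtype, redMat_mapMatrix, RingHom.mapMatrix_apply, Matrix.charpoly_map]

/-- The characteristic polynomial over `E` of `γ_𝒪 ⊗ 1` is `(charpoly γ_𝒪).map 𝒪[E].subtype`. [folklore] -/
private theorem charpoly_coe_map_subtype (γO : GL (Fin n) 𝒪[E]) :
    ((Matrix.GeneralLinearGroup.map (𝒪[E]).subtype γO : GL (Fin n) E) : Matrix (Fin n) (Fin n) E).charpoly =
      (γO : Matrix (Fin n) (Fin n) 𝒪[E]).charpoly.map (𝒪[E]).subtype := by
  rw [coe_map_subtype, RingHom.mapMatrix_apply, Matrix.charpoly_map]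

/-- **(c2) RESIDUALLY SEPARABLE INTEGRAL ELEMENTS WITH THE SAME CHARACTERISTIC POLYNOMIAL ARE `GL_n(𝒪)`-CONJUGATE.**  For `γ, γ′ ∈ GL_n(𝒪) ≤ GL_n(E)`
(★ `glInt`) with `charpoly γ′ = charpoly γ` over `E` and the characteristic polynomial of the reduction `γ̄ = redMat γ ∈ M_n(𝓀)` separable, there is
`k ∈ GL_n(𝒪)` with `k γ k⁻¹ = γ′`.  (★ F1 `exists_isUnit_det_conj_of_charpoly_eq` read in `glInt` tokens: extract the `𝒪`-matrices, compare characteristic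
polynomials through the injective `𝒪 ↪ E`, push the conjugator back to `GL_n(E)`.) [cite: Kottwitz1986, Prop. 7.1] [cite: HornJohnson2013, Thm 3.3.15 p. 257] -/
theorem exists_mem_glInt_conj_eq_of_charpoly_eq_of_separable_redMat {γ γ' : GL (Fin n) E} (hγ : γ ∈ glInt n E) (hγ' : γ' ∈ glInt n E)
    (hchar : ((γ' : GL (Fin n) E) : Matrix (Fin n) (Fin n) E).charpoly = ((γ : GL (Fin n) E) : Matrix (Fin n) (Fin n) E).charpoly)
    (hsep : (redMat ((γ : GL (Fin n) E) : Matrix (Fin n) (Fin n) E)).charpoly.Separable) :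
    ∃ k ∈ glInt n E, k * γ * k⁻¹ = γ' := by
  obtain ⟨γO, rfl⟩ := hγ
  obtain ⟨γO', rfl⟩ := hγ'
  -- the integral characteristic polynomials agree (`𝒪 ↪ E` injective) and the reduction of `p_γ` is separable
  have hcharO : (γO' : Matrix (Fin n) (Fin n) 𝒪[E]).charpoly = (γO : Matrix (Fin n) (Fin n) 𝒪[E]).charpoly := by
    apply Polynomial.map_injective (𝒪[E]).subtype Subtype.val_injective
    rw [← charpoly_coe_map_subtype, ← charpoly_coe_map_subtype, hchar]
  have hsepO : ((γO : Matrix (Fin n) (Fin n) 𝒪[E]).charpoly.map (IsLocalRing.residue 𝒪[E])).Separable := by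
    rw [← charpoly_redMat_map_eq]; exact hsep
  -- ★ F1: `γ_𝒪′ P = P γ_𝒪` with `det P ∈ 𝒪ˣ`
  obtain ⟨P, hP, hPγ⟩ := exists_isUnit_det_conj_of_charpoly_eq (γO : Matrix (Fin n) (Fin n) 𝒪[E]) γO' hsepO hcharO
  have hPU : IsUnit P := (Matrix.isUnit_iff_isUnit_det P).mpr hP
  refine ⟨Matrix.GeneralLinearGroup.map (𝒪[E]).subtype hPU.unit, ⟨hPU.unit, rfl⟩, ?_⟩
  -- `k γ k⁻¹ = γ′` ⟸ `γ′ k = k γ` ⟸ `γ_𝒪′ P = P γ_𝒪`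
  rw [mul_inv_eq_iff_eq_mul, ← map_mul, ← map_mul]
  congr 1
  ext1
  rw [Units.val_mul, Units.val_mul, hPU.unit_spec]
  exact hPγ.symm

/-- **(c3) `(G·γ) ∩ K` IS ONE `K`-CLASS** — the binder `hK1` of ★-pending `ResiduallyRegularOrbitalIntegral` (F0P3b-p01 (g5)), discharged: for `γ ∈ GL_n(𝒪)`
whose reduction has separable characteristic polynomial, every `GL_n(E)`-conjugate of `γ` lying in `GL_n(𝒪)` is a `GL_n(𝒪)`-conjugate of `γ`.
[cite: Kottwitz1986, Prop. 7.1, Cor. 7.3] [cite: Rogawski1990, §4.9 p. 54] -/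
theorem forall_exists_mem_glInt_conj_eq_of_isConj {γ : GL (Fin n) E} (hγ : γ ∈ glInt n E)
    (hsep : (redMat ((γ : GL (Fin n) E) : Matrix (Fin n) (Fin n) E)).charpoly.Separable) :
    ∀ γ' ∈ glInt n E, IsConj γ γ' → ∃ k ∈ glInt n E, k * γ * k⁻¹ = γ' := by
  intro γ' hγ' hconj
  obtain ⟨c, rfl⟩ := isConj_iff.1 hconj
  refine exists_mem_glInt_conj_eq_of_charpoly_eq_of_separable_redMat hγ hγ' ?_ hsep
  have h := Matrix.charpoly_units_conj c ((γ : GL (Fin n) E) : Matrix (Fin n) (Fin n) E)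
  rw [Units.val_mul, Units.val_mul, Matrix.coe_units_inv]
  exact h

/-- **(c5) KOTTWITZ'S ORBIT LEMMA IN `glInt` TOKENS — «`y γ y⁻¹ ∈ K ⇒ y ∈ K · G_γ(E)`»**: for `γ ∈ GL_n(𝒪)` with residually separable characteristic polynomial
and `y ∈ GL_n(E)`, if `y γ y⁻¹ ∈ GL_n(𝒪)` then `y ∈ GL_n(𝒪) · Z_{GL_n(E)}(γ)` (★ F1 `mem_range_map_mul_centralizer_of_conj_mem_range` at `f := 𝒪[E].subtype`;
★ `glInt n E` is that range by definition). [cite: Kottwitz1986, Prop. 7.1] -/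
theorem mem_glInt_mul_centralizer_of_conj_mem_glInt {γ : GL (Fin n) E} (hγ : γ ∈ glInt n E)
    (hsep : (redMat ((γ : GL (Fin n) E) : Matrix (Fin n) (Fin n) E)).charpoly.Separable) (y : GL (Fin n) E)
    (h : y * γ * y⁻¹ ∈ glInt n E) :
    y ∈ ((glInt n E : Subgroup (GL (Fin n) E)) : Set (GL (Fin n) E)) * (Subgroup.centralizer ({γ} : Set (GL (Fin n) E)) : Set (GL (Fin n) E)) := by
  obtain ⟨γO, rfl⟩ := hγ
  have hsepO : ((γO : Matrix (Fin n) (Fin n) 𝒪[E]).charpoly.map (IsLocalRing.residue 𝒪[E])).Separable := by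
    rw [← charpoly_redMat_map_eq]; exact hsep
  exact mem_range_map_mul_centralizer_of_conj_mem_range (𝒪[E]).subtype Subtype.val_injective γO hsepO y h

end Literature.NumberTheory.Automorphic.GLn

end
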